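import Summits.BirchSwinnertonDyer.Rank1Residual.X11b.BDPFrameUniqueness
import Summits.BirchSwinnertonDyer.Rank1Residual.X11b.RouteR1IntReceptacle
import Mathlib.Analysis.SpecificLimits.Normed
import HarnessLib

/-!
# X11b — rigidity and DESCENT for frames over the wide receptacle `𝓞_{ℂ_p}⟦T⟧` (every `p`): an
# element is determined by its values along characters accumulating at `𝟙`; two `Q` with the same
# `R1.IsBDPLFunctionInt` data coincide given a supply; and the COEFFICIENTS of `Q` lie in any closed
# subfield containing a null sequence of points and the values there

HONEST FRAMING (cell `b2b-bsdres`, run/shared/lean/b2b/bsd-rank1-residual/, verbatim in every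
file): the goal of the cell is to DELETE the COMBINATION-SHAPED residual classes of the
Birch–Swinnerton-Dyer formula for ALL analytic-rank `≤ 1` elliptic curves over `ℚ` — "full BSD
formula for every rank `≤ 1` curve in class `C`" assembled STRICTLY from published theorems — so
that the rank-`≤ 1` remainder becomes exactly the CONSTRUCTION-SHAPED classes, which are TYPED
(missing-input `Prop`s), NOT attempted. This is not "finishing BSD". Sub-cell
`b2b-bsdres-multr1-p1` (X11b, route R1, gen 23); THEOREMS ONLY (no definition, no named fact, no
`sorry`); pure `p`-adic analysis valid at every prime `p` and for any reduction type — it uses only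
`‖𝓞_{ℂ_p}‖ ≤ 1`, the `HasSum` currency `IntSeries.HasValueAt` and gen 22's identity principle.

## What this file proves (gen 23; kernel side of `HOME/b2b-bsdres-multr1-p1/DESCENT-NOTE.md`)

* §1 `R1.intSeries_eq_of_hasValueAt`: two `Q, Q' ∈ 𝓞_{ℂ_p}⟦T⟧` with the same values along `x_k → 0`,
  `x_k ≠ 0` infinitely often, are EQUAL (gen 22's `eq_zero_of_norm_le_of_hasSum_zero_of_tendsto_zero`
  on the difference); `R1.isBDPLFunctionInt_unique_of_tendsto`: two `Q` with the SAME data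
  `R1.IsBDPLFunctionInt p ι 𝔭 κ γ f Ω_K Ω_p ·` coincide given a supply `(φ_k, n_k, r_k)` with
  `φ̂_k(γ) → 1`, `≠ 1` infinitely often — STEP A of the descent note ("`L_p(f)_ψ` does not depend on
  `ψ` as an element of `𝓞_{ℂ_p}⟦Γ⟧`") in kernel form, at fixed periods; `…_forall_of_exists_…`.
* §2 **DESCENT OF COEFFICIENTS FROM VALUES** (`R1.coeff_mem_of_hasValueAt_mem`): if `S ⊆ ℂ_p` is a
  CLOSED subfield, `x_k ∈ S ∖ {0}` with `x_k → 0`, and `Q(x_k) = v_k ∈ S` for all `k`, then EVERY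
  coefficient of `Q` lies in `S` — by induction: `(v_k − Σ_{i<n} c_i x_k^i)/x_k^n ∈ S` tends to `c_n`
  (the tail is `x_k·u_k` with `‖u_k‖ ≤ (1 − ‖x_k‖)⁻¹`). With `S = Frac R₀` (closed: complete) this is
  the form in which an `R₀`-RATIONALITY statement about VALUES at `R₀`-rational characters (the
  `k(K,p) = 0` case of x11b3-lit1's L59, where such characters exist) descends to the coefficient
  ring; for `k(K,p) ≥ 1` no such characters exist (L59 (B)) and the note's twist-intersection
  argument is needed instead — nothing about that case is claimed here.

Nothing is asserted about any curve; no label change.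

References: [Castella2018] §2.2, Thm. 3.1 (arXiv:1704.06608 pp. 5, 9); [Hsieh2014] p. 7;
[Cassels1986] J. W. S. Cassels, *Local Fields*, Ch. 4 (Strassmann).
-/

noncomputable section

open scoped Classical Topology ENNReal NNReal

open Filter WeierstrassCurve NumberField IsDedekindDomain Field PowerSeries
open Literature.NumberTheory.EllipticCurves
open Literature.NumberTheory.GaloisRepresentations
open Summit.BirchSwinnertonDyer.Rank1Residual.X11b.Halves

namespace Summit.BirchSwinnertonDyer.Rank1Residual.X11b

variable {p : ℕ} [Fact p.Prime]

/-! ### §1 Rigidity over `𝓞_{ℂ_p}⟦T⟧` -/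

section Rigidity

/-- **An element of `𝓞_{ℂ_p}⟦T⟧` is determined by its values on a sequence accumulating at `T = 0`.**
If `Q, Q'` take the same value (`IntSeries.HasValueAt`) at every `x_k` of a sequence `x_k → 0` with
`x_k ≠ 0` infinitely often, then `Q = Q'` (coefficients of norm `≤ 1`; gen 22's identity principle for
the difference). [cite: Cassels1986, Ch. 4 Thm. 4.1 (Strassmann; bounded variant via isolated zeros)] -/
theorem R1.intSeries_eq_of_hasValueAt {Q Q' : PowerSeries 𝓞_ℂ_[p]} {x v : ℕ → ℂ_[p]}
    (hx : Tendsto x atTop (𝓝 0)) (hx0 : ∃ᶠ k in atTop, x k ≠ 0)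
    (hQ : ∀ k, IntSeries.HasValueAt Q (x k) (v k)) (hQ' : ∀ k, IntSeries.HasValueAt Q' (x k) (v k)) :
    Q = Q' := by
  have key : (fun n ↦ ((PowerSeries.coeff n Q : 𝓞_ℂ_[p]) : ℂ_[p]) -
      ((PowerSeries.coeff n Q' : 𝓞_ℂ_[p]) : ℂ_[p])) = 0 := by
    refine eq_zero_of_norm_le_of_hasSum_zero_of_tendsto_zero (C := 1 + 1) (fun n ↦ ?_) hx hx0
      fun k ↦ ?_
    · exact (norm_sub_le _ _).trans
        (add_le_add (R1.norm_coe_padicComplexInt_le_one p _)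
          (R1.norm_coe_padicComplexInt_le_one p _))
    · have hsub := (hQ k).sub (hQ' k)
      rw [sub_self] at hsub
      refine hsub.congr_fun fun n ↦ ?_
      rw [sub_mul]
  refine PowerSeries.ext fun n ↦ Subtype.ext ?_
  have hn := congrFun key n
  rwa [Pi.zero_apply, sub_eq_zero] at hn

variable {K : Type} [Field K] [NumberField K] {N : ℕ} {ι : PadicAlgCl p ≃+* ℂ}
  {𝔭 : HeightOneSpectrum (𝓞 K)} {κ : ZpExtension K p} {γ : Field.absoluteGaloisGroup K}
  {f : CuspForm (CongruenceSubgroup.Gamma0 N) 2} {ΩK : ℂ} {Ωp : ℂ_[p]}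

/-- **Frame rigidity at fixed periods over the wide receptacle** (STEP A of the descent note in kernel
form): two `Q, Q' ∈ 𝓞_{ℂ_p}⟦T⟧` with the SAME interpolation data `R1.IsBDPLFunctionInt p ι 𝔭 κ γ f Ω_K Ω_p`
are EQUAL, given a supply `(φ_k, n_k, r_k)` of interpolation characters (unramified, type `(-n_k,n_k)`,
`n_k > 0`, avatar `r_k` through `κ`) with `φ̂_k(γ) → 1` and `φ̂_k(γ) ≠ 1` infinitely often. In
particular the twisted elements `Tw_{ψ̂⁻¹}(ℒ_{𝔭,ψ}(f))` for different auxiliary `ψ`, which satisfy the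
same `ψ`-free interpolation formula, are ONE element of `𝓞_{ℂ_p}⟦Γ⟧` whatever their coefficient rings.
[cite: Castella2018, Thm. 3.1 and p. 9 ll. 42–47 (arXiv:1704.06608) (the twist Tw_{ψ⁻¹})] -/
theorem R1.isBDPLFunctionInt_unique_of_tendsto {Q Q' : PowerSeries 𝓞_ℂ_[p]}
    (hQ : R1.IsBDPLFunctionInt p ι 𝔭 κ γ f ΩK Ωp Q) (hQ' : R1.IsBDPLFunctionInt p ι 𝔭 κ γ f ΩK Ωp Q')
    {φ : ℕ → HeckeCharacter K} {n : ℕ → ℕ} {r : ℕ → FramedGaloisRep K (PadicAlgCl p) 1}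
    (hn : ∀ k, 0 < n k) (hunr : ∀ k (v : HeightOneSpectrum (𝓞 K)), (φ k).IsUnramifiedAt v)
    (hinf : ∀ k, (φ k).HasInfinityType (fun _ ↦ (n k : ℤ)) (fun _ ↦ -(n k : ℤ)))
    (hr : ∀ k, IsPAdicAvatarOf ι (φ k) (r k)) (hκ : ∀ k, FactorsThroughZp κ (r k))
    (hlim : Tendsto (fun k ↦ avatarValueAt (r k) γ) atTop (𝓝 1))
    (hne : ∃ᶠ k in atTop, avatarValueAt (r k) γ ≠ 1) : Q = Q' := by
  refine R1.intSeries_eq_of_hasValueAt (x := fun k ↦ avatarValueAt (r k) γ - 1)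
    (v := fun k ↦ ((ι.symm (bdpInterpolationValue p f 𝔭 (φ k) (n k) ΩK) : PadicAlgCl p) : ℂ_[p]) *
      Ωp ^ (4 * n k)) ?_ ?_
    (fun k ↦ hQ (φ k) (n k) (hn k) (hunr k) (hinf k) (r k) (hr k) (hκ k))
    (fun k ↦ hQ' (φ k) (n k) (hn k) (hunr k) (hinf k) (r k) (hr k) (hκ k))
  · rw [← sub_self (1 : ℂ_[p])]
    exact hlim.sub_const 1
  · exact hne.mono fun k hk ↦ sub_ne_zero.mpr hk

/-- **At fixed periods over `𝓞_{ℂ_p}⟦T⟧`, "some `Q` of the frame" = "every `Q` of the frame"** under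
the supply hypothesis. [cite: Castella2018, Thm. 3.1 (arXiv:1704.06608 p. 9)] -/
theorem R1.isBDPLFunctionInt_forall_of_exists_of_tendsto {P : PowerSeries 𝓞_ℂ_[p] → Prop}
    {φ : ℕ → HeckeCharacter K} {n : ℕ → ℕ} {r : ℕ → FramedGaloisRep K (PadicAlgCl p) 1}
    (hn : ∀ k, 0 < n k) (hunr : ∀ k (v : HeightOneSpectrum (𝓞 K)), (φ k).IsUnramifiedAt v)
    (hinf : ∀ k, (φ k).HasInfinityType (fun _ ↦ (n k : ℤ)) (fun _ ↦ -(n k : ℤ)))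
    (hr : ∀ k, IsPAdicAvatarOf ι (φ k) (r k)) (hκ : ∀ k, FactorsThroughZp κ (r k))
    (hlim : Tendsto (fun k ↦ avatarValueAt (r k) γ) atTop (𝓝 1))
    (hne : ∃ᶠ k in atTop, avatarValueAt (r k) γ ≠ 1)
    (hex : ∃ Q, R1.IsBDPLFunctionInt p ι 𝔭 κ γ f ΩK Ωp Q ∧ P Q) {Q' : PowerSeries 𝓞_ℂ_[p]}
    (hQ' : R1.IsBDPLFunctionInt p ι 𝔭 κ γ f ΩK Ωp Q') : P Q' := by
  obtain ⟨Q, hQ, hP⟩ := hex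
  rwa [R1.isBDPLFunctionInt_unique_of_tendsto hQ hQ' hn hunr hinf hr hκ hlim hne] at hP

end Rigidity

/-! ### §2 Descent of coefficients from values -/

section Descent

/-- Tail bound: for `‖c_m‖ ≤ 1` and `‖x‖ < 1` the series `∑_m c_{m+N} x^m` is summable with sum of
norm `≤ (1 − ‖x‖)⁻¹`. [folklore] -/
theorem R1.norm_tsum_shift_le {c : ℕ → ℂ_[p]} (hc : ∀ m, ‖c m‖ ≤ 1) {x : ℂ_[p]} (hx : ‖x‖ < 1)
    (N : ℕ) :
    Summable (fun m ↦ c (m + N) * x ^ m) ∧ ‖∑' m, c (m + N) * x ^ m‖ ≤ (1 - ‖x‖)⁻¹ := by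
  have hgeo : Summable fun m : ℕ ↦ ‖x‖ ^ m := summable_geometric_of_lt_one (norm_nonneg _) hx
  have hbound : ∀ m, ‖c (m + N) * x ^ m‖ ≤ ‖x‖ ^ m := fun m ↦ by
    rw [norm_mul, norm_pow]
    exact mul_le_of_le_one_left (pow_nonneg (norm_nonneg _) _) (hc _)
  have hsn : Summable fun m ↦ ‖c (m + N) * x ^ m‖ :=
    Summable.of_nonneg_of_le (fun _ ↦ norm_nonneg _) hbound hgeo
  refine ⟨hsn.of_norm, ?_⟩
  calc ‖∑' m, c (m + N) * x ^ m‖ ≤ ∑' m, ‖c (m + N) * x ^ m‖ := norm_tsum_le_tsum_norm hsn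
    _ ≤ ∑' m, ‖x‖ ^ m := hsn.tsum_le_tsum hbound hgeo
    _ = (1 - ‖x‖)⁻¹ := tsum_geometric_of_lt_one (norm_nonneg _) hx

/-- **Peeling off the first `n + 1` terms**: if `∑_m c_m x^m = v` (a `HasSum`) with `‖c_m‖ ≤ 1`,
`‖x‖ < 1`, then `v − Σ_{i<n} c_i x^i = c_n x^n + x^{n+1} · ∑'_m c_{m+n+1} x^m`. [folklore] -/
theorem R1.hasSum_peel {c : ℕ → ℂ_[p]} (hc : ∀ m, ‖c m‖ ≤ 1) {x v : ℂ_[p]} (hx : ‖x‖ < 1)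
    (h : HasSum (fun m ↦ c m * x ^ m) v) (n : ℕ) :
    v - ∑ i ∈ Finset.range n, c i * x ^ i =
      c n * x ^ n + x ^ (n + 1) * ∑' m, c (m + (n + 1)) * x ^ m := by
  obtain ⟨hs, -⟩ := R1.norm_tsum_shift_le hc hx (n + 1)
  -- the shifted series
  have htail : HasSum (fun m ↦ c (m + (n + 1)) * x ^ (m + (n + 1)))
      (v - ∑ i ∈ Finset.range (n + 1), c i * x ^ i) :=
    (hasSum_nat_add_iff' (f := fun m ↦ c m * x ^ m) (n + 1)).mpr h
  have htail' : HasSum (fun m ↦ c (m + (n + 1)) * x ^ (m + (n + 1)))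
      (x ^ (n + 1) * ∑' m, c (m + (n + 1)) * x ^ m) := by
    have := hs.hasSum.mul_left (x ^ (n + 1))
    refine this.congr_fun fun m ↦ ?_
    ring
  have heq := htail.unique htail'
  rw [Finset.sum_range_succ] at heq
  -- `v - (S_n + c_n x^n) = x^{n+1} u` ⟹ `v - S_n = c_n x^n + x^{n+1} u`
  linear_combination heq

/-- **DESCENT OF COEFFICIENTS FROM VALUES.** Let `S ⊆ ℂ_p` be a CLOSED subfield, `Q ∈ 𝓞_{ℂ_p}⟦T⟧`,
and `x_k ∈ S`, `x_k ≠ 0`, `x_k → 0`, with values `Q(x_k) = v_k ∈ S` (`IntSeries.HasValueAt`). Then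
every coefficient of `Q` lies in `S`. Induction on `n`: `s_k := (v_k − Σ_{i<n} c_i x_k^i)/x_k^n ∈ S`
(earlier coefficients in `S`) and `s_k − c_n = x_k·u_k` with `‖u_k‖ ≤ (1 − ‖x_k‖)⁻¹ ≤ 2` eventually,
so `s_k → c_n ∈ S̄ = S`. (Use: `S = \widehat{ℚ_p^{ur}}`, complete hence closed — an `R₀`-rationality of
VALUES at `R₀`-rational characters descends to the coefficients; Castella 2018 §2.2 reads `L_p(f)`
through such values.) [cite: Castella2018, §2.2 and Thm. 3.1 (arXiv:1704.06608 pp. 5, 9)] -/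
theorem R1.coeff_mem_of_hasValueAt_mem (S : Subfield ℂ_[p]) (hS : IsClosed (S : Set ℂ_[p]))
    {Q : PowerSeries 𝓞_ℂ_[p]} {x v : ℕ → ℂ_[p]} (hx : Tendsto x atTop (𝓝 0)) (hx0 : ∀ k, x k ≠ 0)
    (hxS : ∀ k, x k ∈ S) (hvS : ∀ k, v k ∈ S) (hQ : ∀ k, IntSeries.HasValueAt Q (x k) (v k))
    (n : ℕ) : ((PowerSeries.coeff n Q : 𝓞_ℂ_[p]) : ℂ_[p]) ∈ S := by
  induction n using Nat.strong_induction_on with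
  | _ n ih =>
    set c : ℕ → ℂ_[p] := fun m ↦ ((PowerSeries.coeff m Q : 𝓞_ℂ_[p]) : ℂ_[p]) with hcdef
    have hc : ∀ m, ‖c m‖ ≤ 1 := fun m ↦ R1.norm_coe_padicComplexInt_le_one p _
    -- eventually `‖x_k‖ < 1/2`
    have hsmall : ∀ᶠ k in atTop, ‖x k‖ < 1 / 2 := by
      have h := (tendsto_order.mp (tendsto_norm_zero.comp hx)).2 (1 / 2) (by norm_num)
      simpa using h
    -- the approximants `s_k ∈ S`
    set s : ℕ → ℂ_[p] := fun k ↦ (v k - ∑ i ∈ Finset.range n, c i * x k ^ i) / x k ^ n with hsdef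
    have hsS : ∀ k, s k ∈ S := by
      intro k
      refine div_mem (sub_mem (hvS k) (sum_mem fun i hi ↦ ?_)) (pow_mem (hxS k) n)
      exact mul_mem (ih i (Finset.mem_range.mp hi)) (pow_mem (hxS k) i)
    -- `s_k - c_n = x_k * u_k` with `‖u_k‖ ≤ 2` for `k` large, hence `s_k → c_n`
    have hlim : Tendsto s atTop (𝓝 (c n)) := by
      rw [tendsto_iff_norm_sub_tendsto_zero]
      have hbd : ∀ᶠ k in atTop, ‖s k - c n‖ ≤ 2 * ‖x k‖ := by
        filter_upwards [hsmall] with k hk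
        have hx1 : ‖x k‖ < 1 := hk.trans (by norm_num)
        obtain ⟨-, hu⟩ := R1.norm_tsum_shift_le hc hx1 (n + 1)
        have hpeel := R1.hasSum_peel hc hx1 (hQ k) n
        have hxn : x k ^ n ≠ 0 := pow_ne_zero _ (hx0 k)
        have hs' : s k - c n = x k * ∑' m, c (m + (n + 1)) * x k ^ m := by
          rw [hsdef]
          simp only
          rw [hpeel, div_sub' hxn]
          field_simp
          ring
        rw [hs', norm_mul]
        have h2 : (1 - ‖x k‖)⁻¹ ≤ 2 := by
          rw [inv_le_comm₀ (by linarith) (by norm_num)]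
          linarith
        calc ‖x k‖ * ‖∑' m, c (m + (n + 1)) * x k ^ m‖ ≤ ‖x k‖ * 2 :=
              mul_le_mul_of_nonneg_left (hu.trans h2) (norm_nonneg _)
          _ = 2 * ‖x k‖ := mul_comm _ _
      have h0 : Tendsto (fun k ↦ 2 * ‖x k‖) atTop (𝓝 0) := by
        simpa using (tendsto_norm_zero.comp hx).const_mul 2
      exact squeeze_zero_norm' (by simpa [Real.norm_eq_abs, abs_of_nonneg (norm_nonneg _)] using hbd) h0
    exact hS.mem_of_tendsto hlim (Eventually.of_forall hsS)

/-- **Descent to `R₀`-type subrings**: under the hypotheses of `R1.coeff_mem_of_hasValueAt_mem`, the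
coefficients of `Q` lie in `S ∩ 𝓞_{ℂ_p}` — so if `S ∩ 𝓞_{ℂ_p} ⊆ R` for a subring `R` (e.g. `R = R₀`
and `S = Frac R₀`), `Q` has all its coefficients in `R`. [cite: Castella2018, §3 (arXiv:1704.06608 p. 9) (R₀ = 𝒪 of the completed maximal unramified extension)] -/
theorem R1.coeff_mem_subring_of_hasValueAt_mem (S : Subfield ℂ_[p]) (hS : IsClosed (S : Set ℂ_[p]))
    (R : Subring ℂ_[p]) (hR : ∀ z : ℂ_[p], z ∈ S → ‖z‖ ≤ 1 → z ∈ R)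
    {Q : PowerSeries 𝓞_ℂ_[p]} {x v : ℕ → ℂ_[p]} (hx : Tendsto x atTop (𝓝 0)) (hx0 : ∀ k, x k ≠ 0)
    (hxS : ∀ k, x k ∈ S) (hvS : ∀ k, v k ∈ S) (hQ : ∀ k, IntSeries.HasValueAt Q (x k) (v k))
    (n : ℕ) : ((PowerSeries.coeff n Q : 𝓞_ℂ_[p]) : ℂ_[p]) ∈ R :=
  hR _ (R1.coeff_mem_of_hasValueAt_mem S hS hx hx0 hxS hvS hQ n)
    (R1.norm_coe_padicComplexInt_le_one p _)

end Descent

end Summit.BirchSwinnertonDyer.Rank1Residual.X11b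

end
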